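/-
Copyright (c) 2026 the pub-hodgecm-mathlib formalisation cell (harness21).  Prover seat hodgecm-mathlib-F0P3b-p01 (g11), 2026-09-01.  Road «S3-tree» (architect A-p16 (g29) A-67 (3)),
brick T3′ «depth-zero κ-transfer», organ O8d-1s «THE TYPE-(1) SOCKET»: the ★ values-abstract adapter composed with ★ O8d-alg — from the STRATA COUNTS of the four literals to the
G-side of HEAD v4's clause `…_typeOne`.
-/
import Literature.NumberTheory.Rogawski1990.UnitFundamentalLemmaInertSplitClauseOfValuesStubFrame   -- ★ the adapter `finsum_finExplicitDelta_mul_classOrbitalIntegral_eq_of_split_of_values'`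
import Literature.NumberTheory.Rogawski1990.DepthZeroTransferMatrixIdentity                        -- ★ O8d-alg (this seat): `depthZero_matrix_identity_rows`
import HarnessLib

/-!
# The type-(1) socket of T3′: from the Jordan-strata counts of Flicker's four literals to `Σᶠ_c Δ‴_v(γ_H, c)·Φ(c, g) = M·(a₀′ W(N−1) + a₁′ w_N)`

Topic `NumberTheory/Rogawski1990`; namespace `Literature.NumberTheory.Rogawski1990`.  THEOREMS ONLY (no definition, no instance, no notation, no named fact, no `sorry`); kernel lane
`--supports stmt-HodgeConjecture-24833`.  Cell `pub/hodgecm-mathlib`, crux H413; road «S3-tree», brick T3′ (holder F0P3b-p01 (g11); HEAD v4 8caecb47 clause `…_typeOne` = DESIGN v2 §2 (P-1)).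
HONEST LABEL: HC_CM is proved only modulo the cell's 2 remaining named inputs (hLiu418, h413) until rung 0 closes; this file is an ASSEMBLY over ★ material and asserts nothing printed.

THE STATEMENT (`finsum_finExplicitDelta_mul_classOrbitalIntegral_eq_of_split_of_strata`).  In the frame of the ★ adapter (unramified non-split `w ∣ v` of good reduction, split eigen-data
`α ≠ γ`, `N₁ = ord(α − u)`, `N₂ = ord(γ − u)`, Flicker's scalars and eigenframe, ANY test function `f` and canonical family `mG`), suppose the four literal VALUES of `f` are
`X_i = M · (c₀ n_{i,0} + c₁ n_{i,1} + c₂ n_{i,2})` (the shape ★ O8b `classOrbitalIntegral_eq_smul_sum_ncard_rankStrata_of_deep` produces for a depth-zero piece: `M = ν_G(K)`,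
`c_r` the stratum values, `n_{i,r}` the Jordan-strata counts of the fixed hyperspecial vertices of the `i`-th literal), and suppose the three κ-SUMS (`κ = (+,+,−,−)`) of the counts are
the unit value `(−q)^{N₁+N₂} W(N)` (★ Flicker + ★ `flicker_theorem15`), the level-one value `(−q)^{N₁+N₂−2} W(N−1)` (★ C1 ∘ ORDER-STABILITY ∘ CAYLEY) and the free count
`(−1)^{N₁+N₂}(q+1)² q^{N₁+N₂+N−2}` (★ O8a).  Then
  `Σᶠ_c Δ‴_v(γ_H, c)·Φ(c, f) = M · ((q⁻²c₀ + ((q²−1)∕q²)c₁)·W(N−1) + (−q⁻¹c₁ + ((q+1)∕q)c₂)·(W(N) − W(N−1)))`,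
i.e. the G-side of HEAD v4's type-(1) clause (the H-side `a₀Φ^st(χ₀) + a₁Φ^st(χ₁)` is this with ★ O8c `Φ^st(χ₀) = ν_H(K_H)W(N−1)`, `Φ^st(χ₁) = ν_H(K_H)w_N`).  PROOF = ★ adapter + the three
rows of ★ `depthZero_matrix_identity_rows` cast to `ℂ`.

## References
* [Rogawski1990] J. D. Rogawski, *Automorphic Representations of Unitary Groups in Three Variables* (1990), §4.9 Prop. 4.9.1 (a)(b) p. 55; §4.3 (4.3.1)–(4.3.2) p. 43; §8.1 Prop. 8.1.1.
* [Flicker1998UnitaryFL] Y. Z. Flicker, *Elementary proof of the fundamental lemma for a unitary group*, Canad. J. Math. 50 (1998), Prop. 3 p. 78, §6 Thm. 15 p. 95.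
-/

set_option autoImplicit false

noncomputable section

open NumberField IsDedekindDomain Matrix Polynomial
open scoped MatrixGroups

namespace Literature.NumberTheory.Rogawski1990

open Literature.NumberTheory.Automorphic Literature.NumberTheory.Automorphic.UnitaryGroup
open Literature.NumberTheory.GaloisRepresentations Literature.NumberTheory.NumberFields Literature.NumberTheory.QuadraticForms

variable (L : Type) [Field L] [NumberField L] [IsCMField L] {v : HeightOneSpectrum (𝓞 ↥(maximalRealSubfield L))} (H' : Matrix (Fin 3) (Fin 3) L)

set_option maxHeartbeats 400000 in
open scoped Classical in
/-- **THE TYPE-(1) SOCKET OF T3′** (see the module docstring): the ★ adapter's `Δ‴`-weighted class sum of ANY `f` whose four literal values are strata-weighted counts with the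
three κ-sums of a depth-zero piece equals `M·(a₀′W(N−1) + a₁′w_N)`. [cite: Rogawski1990, §4.9 Prop. 4.9.1 (a) p. 55; §4.3 (4.3.1)–(4.3.2) p. 43] [cite: Flicker1998UnitaryFL, Prop. 3 p. 78; §6 Thm. 15 p. 95] -/
theorem finsum_finExplicitDelta_mul_classOrbitalIntegral_eq_of_split_of_strata
    (hH' : (H'.map (IsCMField.complexConj L))ᵀ = H') (w : PlacesOver L v)
    (hw : IsCMField.complexConj L • w.1 = w.1) (hv : Algebra.IsUnramifiedIn (𝓞 L) v.asIdeal)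
    (hH'w : IsUnit (placeForm H' w.1)) (hH'i : hH'w.unit ∈ glInt 3 (w.1.adicCompletion L))
    (μ : HeckeCharacter L) (hμ : μ.IsUnramifiedAt w.1)
    [∀ γ : ((cmDatum L 3 H').Local v), MeasurableSpace (((cmDatum L 3 H').Local v) ⧸ Subgroup.centralizer ({γ} : Set ((cmDatum L 3 H').Local v)))]
    (hl : ∀ (v : HeightOneSpectrum (𝓞 ↥(maximalRealSubfield L)))
      (a : (cmDatum L 2 (Matrix.of fun i j : Fin 2 => if i.val + j.val + 1 = 2 then (1 : L) else 0)).Local v ×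
      (cmDatum L 1 (Matrix.of fun i j : Fin 1 => if i.val + j.val + 1 = 1 then (1 : L) else 0)).Local v)
      (b : (cmDatum L 3 H').Local v)
      (x : (cmDatum L 2 (Matrix.of fun i j : Fin 2 => if i.val + j.val + 1 = 2 then (1 : L) else 0)).Local v ×
      (cmDatum L 1 (Matrix.of fun i j : Fin 1 => if i.val + j.val + 1 = 1 then (1 : L) else 0)).Local v),
      finExplicitDelta L v H' (x * a * x⁻¹) μ b = finExplicitDelta L v H' a μ b)
    (hr : ∀ (v : HeightOneSpectrum (𝓞 ↥(maximalRealSubfield L)))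
      (a : (cmDatum L 2 (Matrix.of fun i j : Fin 2 => if i.val + j.val + 1 = 2 then (1 : L) else 0)).Local v ×
      (cmDatum L 1 (Matrix.of fun i j : Fin 1 => if i.val + j.val + 1 = 1 then (1 : L) else 0)).Local v)
      (b y : (cmDatum L 3 H').Local v),
      finExplicitDelta L v H' a μ (y * b * y⁻¹) = finExplicitDelta L v H' a μ b)
    (hH'u : IsUnit H')
    (hμω : ∀ x : ideleGroup ↥(maximalRealSubfield L), μ (AdeleRing.ideleBaseChange ↥(maximalRealSubfield L) L x) = quadraticHeckeCharCM L x)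
    {γH : ((cmDatum L 2 (Matrix.of fun i j : Fin 2 => if i.val + j.val + 1 = 2 then (1 : L) else 0)).Local v ×
      (cmDatum L 1 (Matrix.of fun i j : Fin 1 => if i.val + j.val + 1 = 1 then (1 : L) else 0)).Local v)}
    -- the split eigen-data of `stub_splitExponents`
    (α γ : w.1.adicCompletion L) (N₁ N₂ : ℕ)
    (hα : ((((γH.1.val : GL (Fin 2) (LocalRing L v)) : Matrix (Fin 2) (Fin 2) (LocalRing L v)).charpoly).map
        (Pi.evalRingHom (fun w' : PlacesOver L v => w'.1.adicCompletion L) w)).IsRoot α)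
    (hγ : ((((γH.1.val : GL (Fin 2) (LocalRing L v)) : Matrix (Fin 2) (Fin 2) (LocalRing L v)).charpoly).map
        (Pi.evalRingHom (fun w' : PlacesOver L v => w'.1.adicCompletion L) w)).IsRoot γ)
    (hαγ : α ≠ γ)
    (hN₁ : Valued.v (α - finGammaTwo L v γH w) = WithZero.exp (-(N₁ : ℤ)))
    (hN₂ : Valued.v (γ - finGammaTwo L v γH w) = WithZero.exp (-(N₂ : ℤ)))
    -- Flicker's scalars (★ `exists_flicker_scalars_of_nonsplit`) and an eigenframe of `g` over `E_v` (★ (E1))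
    {e π π' x y a d : LocalRing L v} (h2e : 2 * e = 1) (hσπ : conjLocal L (IsCMField.complexConj L) v π = π) (hππ : π * π' = 1)
    (hπN : ∀ z : LocalRing L v, conjLocal L (IsCMField.complexConj L) v z * z ≠ π)
    (hx : conjLocal L (IsCMField.complexConj L) v x * x = 2) (hy : conjLocal L (IsCMField.complexConj L) v y * y = -2)
    (ha1 : conjLocal L (IsCMField.complexConj L) v a * a = 1) (hd1 : conjLocal L (IsCMField.complexConj L) v d * d = 1)
    {P₂ : GL (Fin 2) (LocalRing L v)} (hP₂ : (γH.1.val.val : Matrix (Fin 2) (Fin 2) (LocalRing L v)) * P₂.val = P₂.val * diagonal ![a, d])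
    (had : a ≠ d) (hab : a ≠ finGammaTwo L v γH) (hbd : finGammaTwo L v γH ≠ d)
    -- the test function, the family, and the four VALUES labelled by Flicker's literals
    (mG : OrbitalMeasureFamily ((cmDatum L 3 H').Local v)) (f : (cmDatum L 3 H').Local v → ℂ) 
    -- the H-depth, deepness, the piece's stratum values `c`, the mass `M = ν_G(K)`, and the STRATA COUNTS `n i r` of the four literals with their three κ-sums
    (N : ℕ) (hN : 1 ≤ N) (h₁ : 1 ≤ N₁) (h₂ : 1 ≤ N₂) (hq : 1 < Ideal.absNorm v.asIdeal) (M : ℂ) (c : ℕ → ℂ) (n : Fin 4 → ℕ → ℕ)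
    (hK : ((n 0 0 + n 0 1 + n 0 2 + (n 1 0 + n 1 1 + n 1 2) : ℕ) : ℚ) - ((n 2 0 + n 2 1 + n 2 2 + (n 3 0 + n 3 1 + n 3 2) : ℕ) : ℚ) =
      (-(Ideal.absNorm v.asIdeal : ℚ)) ^ (N₁ + N₂) * Flicker1998.phiH (Ideal.absNorm v.asIdeal) N)
    (hK₀ : ((n 0 0 + n 1 0 : ℕ) : ℚ) - ((n 2 0 + n 3 0 : ℕ) : ℚ) = (-(Ideal.absNorm v.asIdeal : ℚ)) ^ (N₁ + N₂ - 2) * Flicker1998.phiH (Ideal.absNorm v.asIdeal) (N - 1))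
    (hK₂ : ((n 0 2 + n 1 2 : ℕ) : ℚ) - ((n 2 2 + n 3 2 : ℕ) : ℚ) =
      (-1 : ℚ) ^ (N₁ + N₂) * ((Ideal.absNorm v.asIdeal : ℚ) + 1) ^ 2 * (Ideal.absNorm v.asIdeal : ℚ) ^ (N₁ + N₂ + N - 2))
    (hΦ₁ : ∀ (Tl : GL (Fin 3) (LocalRing L v)) (ψ : ↥(UnitaryGroup.«local» L (IsCMField.complexConj L) 3 H' v) ≃ₜ*
        ↥(UnitaryGroup.«local» L (IsCMField.complexConj L) 3 (Matrix.of fun i j : Fin 3 => if i.val + j.val + 1 = 3 then (1 : L) else 0) v))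
      (t : (cmDatum L 3 H').Local v),
      formCongr (conjLocal L (IsCMField.complexConj L) v) Tl (Matrix.of fun i j : Fin 3 => if i.val + j.val + 1 = 3 then (1 : LocalRing L v) else 0) =
          (adelicForm L 3 H').map (adeleToLocal L v) →
      (∀ g, (ψ g).val = Tl * g.val * Tl⁻¹) →
      (∀ g, g ∈ cmLocalIntegralLevel L 3 H' v ↔
        ψ g ∈ cmLocalIntegralLevel L 3 (Matrix.of fun i j : Fin 3 => if i.val + j.val + 1 = 3 then (1 : L) else 0) v) →
      (ψ t).val.val =
          !![e * (a + d), 0, -(e * (a - d)); 0, finGammaTwo L v γH, 0; -(e * (a - d)), 0, e * (a + d)] →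
      classOrbitalIntegral mG f (ConjClasses.mk t) = M * (c 0 * (n 0 0 : ℂ) + c 1 * (n 0 1 : ℂ) + c 2 * (n 0 2 : ℂ)))
    (hΦ₂ : ∀ (Tl : GL (Fin 3) (LocalRing L v)) (ψ : ↥(UnitaryGroup.«local» L (IsCMField.complexConj L) 3 H' v) ≃ₜ*
        ↥(UnitaryGroup.«local» L (IsCMField.complexConj L) 3 (Matrix.of fun i j : Fin 3 => if i.val + j.val + 1 = 3 then (1 : L) else 0) v))
      (t : (cmDatum L 3 H').Local v),
      formCongr (conjLocal L (IsCMField.complexConj L) v) Tl (Matrix.of fun i j : Fin 3 => if i.val + j.val + 1 = 3 then (1 : LocalRing L v) else 0) =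
          (adelicForm L 3 H').map (adeleToLocal L v) →
      (∀ g, (ψ g).val = Tl * g.val * Tl⁻¹) →
      (∀ g, g ∈ cmLocalIntegralLevel L 3 H' v ↔
        ψ g ∈ cmLocalIntegralLevel L 3 (Matrix.of fun i j : Fin 3 => if i.val + j.val + 1 = 3 then (1 : L) else 0) v) →
      (ψ t).val.val =
          !![e * (a + d), 0, -(e * (a - d) * π); 0, finGammaTwo L v γH, 0; -(e * (a - d) * π'), 0, e * (a + d)] →
      classOrbitalIntegral mG f (ConjClasses.mk t) = M * (c 0 * (n 1 0 : ℂ) + c 1 * (n 1 1 : ℂ) + c 2 * (n 1 2 : ℂ)))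
    (hΦ₃ : ∀ (Tl : GL (Fin 3) (LocalRing L v)) (ψ : ↥(UnitaryGroup.«local» L (IsCMField.complexConj L) 3 H' v) ≃ₜ*
        ↥(UnitaryGroup.«local» L (IsCMField.complexConj L) 3 (Matrix.of fun i j : Fin 3 => if i.val + j.val + 1 = 3 then (1 : L) else 0) v))
      (t : (cmDatum L 3 H').Local v),
      formCongr (conjLocal L (IsCMField.complexConj L) v) Tl (Matrix.of fun i j : Fin 3 => if i.val + j.val + 1 = 3 then (1 : LocalRing L v) else 0) =
          (adelicForm L 3 H').map (adeleToLocal L v) →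
      (∀ g, (ψ g).val = Tl * g.val * Tl⁻¹) →
      (∀ g, g ∈ cmLocalIntegralLevel L 3 H' v ↔
        ψ g ∈ cmLocalIntegralLevel L 3 (Matrix.of fun i j : Fin 3 => if i.val + j.val + 1 = 3 then (1 : L) else 0) v) →
      (ψ t).val.val =
          !![e * (a + finGammaTwo L v γH), 0, -(e * (a - finGammaTwo L v γH) * π); 0, d, 0;
             -(e * (a - finGammaTwo L v γH) * π'), 0, e * (a + finGammaTwo L v γH)] →
      classOrbitalIntegral mG f (ConjClasses.mk t) = M * (c 0 * (n 2 0 : ℂ) + c 1 * (n 2 1 : ℂ) + c 2 * (n 2 2 : ℂ)))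
    (hΦ₄ : ∀ (Tl : GL (Fin 3) (LocalRing L v)) (ψ : ↥(UnitaryGroup.«local» L (IsCMField.complexConj L) 3 H' v) ≃ₜ*
        ↥(UnitaryGroup.«local» L (IsCMField.complexConj L) 3 (Matrix.of fun i j : Fin 3 => if i.val + j.val + 1 = 3 then (1 : L) else 0) v))
      (t : (cmDatum L 3 H').Local v),
      formCongr (conjLocal L (IsCMField.complexConj L) v) Tl (Matrix.of fun i j : Fin 3 => if i.val + j.val + 1 = 3 then (1 : LocalRing L v) else 0) =
          (adelicForm L 3 H').map (adeleToLocal L v) →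
      (∀ g, (ψ g).val = Tl * g.val * Tl⁻¹) →
      (∀ g, g ∈ cmLocalIntegralLevel L 3 H' v ↔
        ψ g ∈ cmLocalIntegralLevel L 3 (Matrix.of fun i j : Fin 3 => if i.val + j.val + 1 = 3 then (1 : L) else 0) v) →
      (ψ t).val.val =
          !![e * (finGammaTwo L v γH + d), 0, -(e * (finGammaTwo L v γH - d) * π); 0, a, 0;
             -(e * (finGammaTwo L v γH - d) * π'), 0, e * (finGammaTwo L v γH + d)] →
      classOrbitalIntegral mG f (ConjClasses.mk t) = M * (c 0 * (n 3 0 : ℂ) + c 1 * (n 3 1 : ℂ) + c 2 * (n 3 2 : ℂ))) :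
    ∑ᶠ c : ConjClasses ((cmDatum L 3 H').Local v),
        (finExplicitCollection L H' μ hl hr v).Δ γH (Quotient.out c) * classOrbitalIntegral mG f c =
      M * (((((Ideal.absNorm v.asIdeal : ℂ)) ^ 2)⁻¹ * c 0 + ((((Ideal.absNorm v.asIdeal : ℂ)) ^ 2 - 1) / ((Ideal.absNorm v.asIdeal : ℂ)) ^ 2) * c 1) *
          ((Flicker1998.phiH (Ideal.absNorm v.asIdeal) (N - 1) : ℚ) : ℂ) +
        (-((Ideal.absNorm v.asIdeal : ℂ))⁻¹ * c 1 + ((((Ideal.absNorm v.asIdeal : ℂ)) + 1) / ((Ideal.absNorm v.asIdeal : ℂ))) * c 2) *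
          ((Flicker1998.phiH (Ideal.absNorm v.asIdeal) N - Flicker1998.phiH (Ideal.absNorm v.asIdeal) (N - 1) : ℚ) : ℂ)) := by
  -- the ★ adapter with the four values `X_i := M · Σ_r c_r n_{i,r}`
  rw [finsum_finExplicitDelta_mul_classOrbitalIntegral_eq_of_split_of_values' L H' hH' w hw hv hH'w hH'i μ hμ hl hr hH'u hμω α γ N₁ N₂ hα hγ hαγ hN₁ hN₂
    h2e hσπ hππ hπN hx hy ha1 hd1 hP₂ had hab hbd mG f hΦ₁ hΦ₂ hΦ₃ hΦ₄]
  -- the three rows of the matrix identity (★ O8d-alg), cast to `ℂ`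
  obtain ⟨r0, r1, r2⟩ := Flicker1998.depthZero_matrix_identity_rows hq h₁ h₂ hN hK hK₀ hK₂
  have hz : (-(Ideal.absNorm v.asIdeal : ℂ)) ^ (-((N₁ : ℤ) + N₂)) = ((-(Ideal.absNorm v.asIdeal : ℂ)) ^ (N₁ + N₂))⁻¹ := by
    rw [← Nat.cast_add, _root_.zpow_neg, zpow_natCast]
  have r0' := congrArg (fun x : ℚ => (x : ℂ)) r0
  have r1' := congrArg (fun x : ℚ => (x : ℂ)) r1
  have r2' := congrArg (fun x : ℚ => (x : ℂ)) r2
  push_cast at r0' r1' r2'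
  rw [hz]
  push_cast
  linear_combination M * (c 0 * r0' + c 1 * r1' + c 2 * r2')


end Literature.NumberTheory.Rogawski1990

end
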